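import Summits.ResolutionOfSingularities.ResolutionOfSingularities.Theorems.FrobeniusLadderFRationalResolutionRegularSequenceOpenLocus
import Literature.AlgebraicGeometry.Resolution.FieldsJ2
import Literature.AlgebraicGeometry.Resolution.NagataCriterion
import Mathlib.RingTheory.KrullDimension.Regular
import HarnessLib

/-!
# Crux `FrobeniusLadder.FRationalResolution` (stmt-ResolutionOfSingularities-15317), line `redirect`,
# stub `stub_diagonalizableQuotientResolution` — the coordinate strata of a regular sequence with
# regular quotients stay so on a Zariski NEIGHBOURHOOD (the "snc near a point" lemma; Kato (7.1)
# openness for the FREE chart of a regular system of parameters)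

For `A` of finite type over a field, a prime `𝔔` and elements `x₁,…,x_n ∈ A`: if at `𝔔` every
sub-family `x_I ⊆ 𝔔` is a weakly regular sequence on `A_𝔔` with `A_𝔔/(x_I)` a regular local ring
(e.g. `x` a regular system of parameters of the regular local ring `A_𝔔`), then the same holds at
every prime `𝔔'` of a basic open neighbourhood `D(f) ∋ 𝔔`, for every sub-family `x_I ⊆ 𝔔'`, and
there `dim A_𝔔'/(x_I) + |I| = dim A_𝔔'`. Equivalently: the chart `ℕⁿ → A`, `eᵢ ↦ xᵢ`, which is
Kato-log-regular at `𝔔`, is Kato-log-regular on a neighbourhood (Kato 1994 Prop. (7.1) with the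
J-2 property of fields, for free monoids). Ingredients: openness of the weakly-regular locus
(`…RegularSequenceOpenLocus`, this line), openness of the regular locus of the finite-type
`k`-algebras `A/(x_I)` (`isOpen_regularLocus_of_finiteType_field`, Matsumura Cor. to 30.5), the
transport `A_𝔮/I A_𝔮 ≅ (A/I)_{𝔮/I}` (`isRegularLocalRing_localization_quotient_iff`) and Mathlib's
`dim R/(regular sequence) + length = dim R`.

* `map_ofList`, `exists_mem_of_prod_mem`, `not_mem_of_dvd` — bookkeeping;
* `exists_nhd_quotient_isRegularLocalRing` — ONE stratum: `A_𝔔/(ys)` regular ⇒ `A_𝔔'/(ys)`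
  regular for `𝔔' ⊇ (ys)` near `𝔔`;
* `exists_nhd_isRegular_and_dim` — ONE sequence: `ys` weakly `A_𝔔`-regular ⇒ near `𝔔`, at primes
  containing `ys`, it is `A_𝔔'`-regular and `dim A_𝔔'/(ys) + |ys| = dim A_𝔔'`;
* **`exists_nhd_forall_sublist`** — all sub-families of `xs` at once (one `f ∉ 𝔔`).

Honest label: generic commutative-algebra brick toward the Kato (7.1) step of the census (no stub
closed). No definitions, no named facts, no sorry.
[folklore; cite: Kato1994, Prop. (7.1)] [cite: Matsumura1987, §30, Cor. to Thm. 30.5]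
[cite: BrunsHerzog1998, Prop. 1.1.6]
-/

noncomputable section

-- single-problem summit: the doubled namespace component is forced
set_option linter.dupNamespace false

open RingTheory.Sequence PrimeSpectrum Literature.AlgebraicGeometry.Resolution

namespace Summit.ResolutionOfSingularities.ResolutionOfSingularities.Theorems.FRationalResolution.StrataRegularNhd

universe u

variable {A : Type u} [CommRing A]

/-- `(ys).map g = (g ys)` for the ideal of a list. [folklore] -/
theorem map_ofList {B : Type*} [CommRing B] (g : A →+* B) (ys : List A) :
    (Ideal.ofList ys).map g = Ideal.ofList (ys.map g) := by
  rw [Ideal.ofList, Ideal.ofList, Ideal.map_span]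
  congr 1
  ext b
  simp only [Set.mem_image, Set.mem_setOf_eq, List.mem_map]

/-- In a prime ideal, a product of a list lies in `𝔭` only if some member does. [folklore] -/
theorem exists_mem_of_prod_mem {𝔭 : Ideal A} (h𝔭 : 𝔭.IsPrime) :
    ∀ l : List A, l.prod ∈ 𝔭 → ∃ y ∈ l, y ∈ 𝔭
  | [], h => (h𝔭.ne_top ((Ideal.eq_top_iff_one _).mpr (by simpa using h))).elim
  | (a :: l), h => by
    rw [List.prod_cons] at h
    rcases h𝔭.mem_or_mem h with ha | hl
    · exact ⟨a, List.mem_cons_self, ha⟩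
    · obtain ⟨y, hy, hy𝔭⟩ := exists_mem_of_prod_mem h𝔭 l hl
      exact ⟨y, List.mem_cons_of_mem a hy, hy𝔭⟩

/-- A divisor of an element outside a prime is outside it. [folklore] -/
theorem not_mem_of_dvd {𝔭 : Ideal A} {a b : A} (h : a ∣ b) (hb : b ∉ 𝔭) : a ∉ 𝔭 := by
  rintro ha
  obtain ⟨c, rfl⟩ := h
  exact hb (𝔭.mul_mem_right c ha)

/-- **One stratum spreads**: for `A` of finite type over a field `k`, a prime `𝔔` and
`ys ⊆ 𝔔` with `A_𝔔/(ys)A_𝔔` a regular local ring, there is `g ∉ 𝔔` such that `A_𝔔'/(ys)A_𝔔'` is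
a regular local ring for every prime `𝔔' ∌ g` containing `ys` (openness of `Reg(A/(ys))`,
Matsumura Cor. to Thm. 30.5, transported through `A_𝔮/(ys)A_𝔮 ≅ (A/(ys))_{𝔮/(ys)}`).
[cite: Matsumura1987, §30, Cor. to Thm. 30.5] -/
theorem exists_nhd_quotient_isRegularLocalRing (k : Type u) [Field k] [Algebra k A]
    [Algebra.FiniteType k A] (𝔔 : PrimeSpectrum A) (ys : List A) (hys : ∀ y ∈ ys, y ∈ 𝔔.asIdeal)
    (hreg : IsRegularLocalRing (Localization.AtPrime 𝔔.asIdeal ⧸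
      (Ideal.ofList ys).map (algebraMap A (Localization.AtPrime 𝔔.asIdeal)))) :
    ∃ g : A, g ∉ 𝔔.asIdeal ∧ ∀ 𝔔' : PrimeSpectrum A, g ∉ 𝔔'.asIdeal →
      (∀ y ∈ ys, y ∈ 𝔔'.asIdeal) →
      IsRegularLocalRing (Localization.AtPrime 𝔔'.asIdeal ⧸
        (Ideal.ofList ys).map (algebraMap A (Localization.AtPrime 𝔔'.asIdeal))) := by
  set J : Ideal A := Ideal.ofList ys with hJ
  have hJle : ∀ (𝔮 : PrimeSpectrum A), (∀ y ∈ ys, y ∈ 𝔮.asIdeal) → J ≤ 𝔮.asIdeal :=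
    fun 𝔮 h => Ideal.span_le.mpr fun y hy => h y hy
  have hJ𝔔 : J ≤ 𝔔.asIdeal := hJle 𝔔 hys
  -- the regular locus of `A/J` is open and contains `𝔔/J`
  have hU := isOpen_regularLocus_of_finiteType_field k (A ⧸ J)
  haveI h𝔔' : (𝔔.asIdeal.map (Ideal.Quotient.mk J)).IsPrime :=
    Ideal.isPrime_map_quotientMk_of_isPrime hJ𝔔
  let q₀ : PrimeSpectrum (A ⧸ J) := ⟨𝔔.asIdeal.map (Ideal.Quotient.mk J), h𝔔'⟩
  have hq₀ : q₀ ∈ regularLocus (A ⧸ J) := by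
    rw [mem_regularLocus]
    exact (isRegularLocalRing_localization_quotient_iff J 𝔔.asIdeal hJ𝔔).mp hreg
  obtain ⟨_, ⟨b', rfl⟩, hbq₀, hbU⟩ :=
    PrimeSpectrum.isTopologicalBasis_basic_opens.exists_subset_of_mem_open hq₀ hU
  obtain ⟨b, rfl⟩ := Ideal.Quotient.mk_surjective b'
  refine ⟨b, ?_, fun 𝔔' hb𝔔' hys' => ?_⟩
  · have h := (PrimeSpectrum.mem_basicOpen _ q₀).mp hbq₀
    exact fun hb => h ((Ideal.mem_quotient_iff_mem hJ𝔔).mpr hb)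
  · have hJ𝔔' : J ≤ 𝔔'.asIdeal := hJle 𝔔' hys'
    haveI h𝔔'' : (𝔔'.asIdeal.map (Ideal.Quotient.mk J)).IsPrime :=
      Ideal.isPrime_map_quotientMk_of_isPrime hJ𝔔'
    let q : PrimeSpectrum (A ⧸ J) := ⟨𝔔'.asIdeal.map (Ideal.Quotient.mk J), h𝔔''⟩
    have hq : q ∈ regularLocus (A ⧸ J) := by
      apply hbU
      rw [SetLike.mem_coe, PrimeSpectrum.mem_basicOpen]
      exact fun h => hb𝔔' ((Ideal.mem_quotient_iff_mem hJ𝔔').mp h)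
    rw [mem_regularLocus] at hq
    exact (isRegularLocalRing_localization_quotient_iff J 𝔔'.asIdeal hJ𝔔').mpr hq

/-- **One sequence spreads, with the dimension count**: for `A` Noetherian, a prime `𝔔` and `ys`
whose images form a weakly regular sequence on `A_𝔔`, there is `g ∉ 𝔔` such that for every prime
`𝔔' ∌ g` CONTAINING `ys` the images form an `A_𝔔'`-regular sequence and
`dim A_𝔔'/(ys) + |ys| = dim A_𝔔'`. [cite: BrunsHerzog1998, Prop. 1.1.6] -/
theorem exists_nhd_isRegular_and_dim [IsNoetherianRing A] (𝔔 : PrimeSpectrum A) (ys : List A)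
    (hseq : IsWeaklyRegular (Localization.AtPrime 𝔔.asIdeal)
      (ys.map (algebraMap A (Localization.AtPrime 𝔔.asIdeal)))) :
    ∃ g : A, g ∉ 𝔔.asIdeal ∧ ∀ 𝔔' : PrimeSpectrum A, g ∉ 𝔔'.asIdeal →
      (∀ y ∈ ys, y ∈ 𝔔'.asIdeal) →
      IsRegular (Localization.AtPrime 𝔔'.asIdeal)
          (ys.map (algebraMap A (Localization.AtPrime 𝔔'.asIdeal))) ∧
        ringKrullDim (Localization.AtPrime 𝔔'.asIdeal ⧸
            (Ideal.ofList ys).map (algebraMap A (Localization.AtPrime 𝔔'.asIdeal))) + ys.length =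
          ringKrullDim (Localization.AtPrime 𝔔'.asIdeal) := by
  obtain ⟨g, hg, hnhd⟩ := RegularSequenceOpenLocus.exists_nhd_isWeaklyRegular_self ys 𝔔 hseq
  refine ⟨g, hg, fun 𝔔' hg' hys' => ?_⟩
  have hw := hnhd 𝔔' hg'
  have hmem : ∀ r ∈ ys.map (algebraMap A (Localization.AtPrime 𝔔'.asIdeal)),
      r ∈ IsLocalRing.maximalIdeal (Localization.AtPrime 𝔔'.asIdeal) := by
    intro r hr
    obtain ⟨y, hy, rfl⟩ := List.mem_map.mp hr
    exact (IsLocalization.AtPrime.to_map_mem_maximal_iff (Localization.AtPrime 𝔔'.asIdeal)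
      𝔔'.asIdeal y).mpr (hys' y hy)
  have hR : IsRegular (Localization.AtPrime 𝔔'.asIdeal)
      (ys.map (algebraMap A (Localization.AtPrime 𝔔'.asIdeal))) :=
    IsRegular.of_isWeaklyRegular_of_mem_maximalIdeal _ hmem hw
  refine ⟨hR, ?_⟩
  have hdim := ringKrullDim_add_length_eq_ringKrullDim_of_isRegular _ hR
  rwa [List.length_map, ← map_ofList] at hdim

/-- **All coordinate strata at once (the "snc near a point" lemma).** Let `A` be of finite type
over a field `k`, `𝔔` a prime and `xs` a list of elements of `A` such that, at `𝔔`, every sub-list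
`ys ⊆ 𝔔` of `xs` has regular quotient `A_𝔔/(ys)A_𝔔` and weakly `A_𝔔`-regular images (both hold
when `xs ∩ 𝔔` is part of a regular system of parameters of a regular `A_𝔔`). Then there is
`f ∉ 𝔔` such that for EVERY prime `𝔔' ∌ f` and every sub-list `ys ⊆ 𝔔'` of `xs`:
`A_𝔔'/(ys)A_𝔔'` is a regular local ring, the images of `ys` form an `A_𝔔'`-regular sequence, and
`dim A_𝔔'/(ys)A_𝔔' + |ys| = dim A_𝔔'` — i.e. Kato's (2.1) for the free chart `eᵢ ↦ xᵢ` holds on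
the neighbourhood `D(f)` (Kato 1994 (7.1) + J-2, free-monoid case).
[folklore; cite: Kato1994, Prop. (7.1)] [cite: Matsumura1987, §30, Cor. to Thm. 30.5] -/
theorem exists_nhd_forall_sublist (k : Type u) [Field k] [Algebra k A] [Algebra.FiniteType k A]
    (𝔔 : PrimeSpectrum A) (xs : List A)
    (hreg : ∀ ys : List A, ys.Sublist xs → (∀ y ∈ ys, y ∈ 𝔔.asIdeal) →
      IsRegularLocalRing (Localization.AtPrime 𝔔.asIdeal ⧸
        (Ideal.ofList ys).map (algebraMap A (Localization.AtPrime 𝔔.asIdeal))))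
    (hseq : ∀ ys : List A, ys.Sublist xs → (∀ y ∈ ys, y ∈ 𝔔.asIdeal) →
      IsWeaklyRegular (Localization.AtPrime 𝔔.asIdeal)
        (ys.map (algebraMap A (Localization.AtPrime 𝔔.asIdeal)))) :
    ∃ f : A, f ∉ 𝔔.asIdeal ∧ ∀ 𝔔' : PrimeSpectrum A, f ∉ 𝔔'.asIdeal →
      ∀ ys : List A, ys.Sublist xs → (∀ y ∈ ys, y ∈ 𝔔'.asIdeal) →
        IsRegularLocalRing (Localization.AtPrime 𝔔'.asIdeal ⧸
            (Ideal.ofList ys).map (algebraMap A (Localization.AtPrime 𝔔'.asIdeal))) ∧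
          IsRegular (Localization.AtPrime 𝔔'.asIdeal)
            (ys.map (algebraMap A (Localization.AtPrime 𝔔'.asIdeal))) ∧
          ringKrullDim (Localization.AtPrime 𝔔'.asIdeal ⧸
              (Ideal.ofList ys).map (algebraMap A (Localization.AtPrime 𝔔'.asIdeal))) +
              ys.length = ringKrullDim (Localization.AtPrime 𝔔'.asIdeal) := by
  classical
  haveI : IsNoetherianRing A := Algebra.FiniteType.isNoetherianRing k A
  -- (0) keep the members of `xs` outside `𝔔` outside `𝔔'`
  let f₀ : A := ((xs.filter fun y => y ∉ 𝔔.asIdeal).map id).prod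
  have hf₀ : f₀ ∉ 𝔔.asIdeal := by
    intro h
    obtain ⟨y, hy, hy𝔔⟩ := exists_mem_of_prod_mem 𝔔.isPrime _ h
    rw [List.map_id, List.mem_filter] at hy
    exact (of_decide_eq_true hy.2) hy𝔔
  have hsub : ∀ 𝔔' : PrimeSpectrum A, f₀ ∉ 𝔔'.asIdeal → ∀ y ∈ xs, y ∈ 𝔔'.asIdeal →
      y ∈ 𝔔.asIdeal := by
    intro 𝔔' h𝔔' y hy hy'
    by_contra hy𝔔
    have hmem : y ∈ (xs.filter fun y => y ∉ 𝔔.asIdeal).map id := by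
      rw [List.map_id, List.mem_filter]; exact ⟨hy, decide_eq_true hy𝔔⟩
    exact not_mem_of_dvd (List.dvd_prod hmem) h𝔔' hy'
  -- (1) per sub-list: the two neighbourhoods
  let g₁ : List A → A := fun ys =>
    if h : ys.Sublist xs ∧ ∀ y ∈ ys, y ∈ 𝔔.asIdeal then
      Classical.choose (exists_nhd_quotient_isRegularLocalRing k 𝔔 ys h.2 (hreg ys h.1 h.2))
    else 1
  let g₂ : List A → A := fun ys =>
    if h : ys.Sublist xs ∧ ∀ y ∈ ys, y ∈ 𝔔.asIdeal then
      Classical.choose (exists_nhd_isRegular_and_dim 𝔔 ys (hseq ys h.1 h.2))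
    else 1
  have hg₁ : ∀ ys, g₁ ys ∉ 𝔔.asIdeal := by
    intro ys
    by_cases h : ys.Sublist xs ∧ ∀ y ∈ ys, y ∈ 𝔔.asIdeal
    · simp only [g₁, dif_pos h]
      exact (Classical.choose_spec
        (exists_nhd_quotient_isRegularLocalRing k 𝔔 ys h.2 (hreg ys h.1 h.2))).1
    · simp only [g₁, dif_neg h]
      exact fun h1 => 𝔔.isPrime.ne_top ((Ideal.eq_top_iff_one _).mpr h1)
  have hg₂ : ∀ ys, g₂ ys ∉ 𝔔.asIdeal := by
    intro ys
    by_cases h : ys.Sublist xs ∧ ∀ y ∈ ys, y ∈ 𝔔.asIdeal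
    · simp only [g₂, dif_pos h]
      exact (Classical.choose_spec (exists_nhd_isRegular_and_dim 𝔔 ys (hseq ys h.1 h.2))).1
    · simp only [g₂, dif_neg h]
      exact fun h1 => 𝔔.isPrime.ne_top ((Ideal.eq_top_iff_one _).mpr h1)
  -- (2) one element for all sub-lists
  let f : A := f₀ * (xs.sublists.map fun ys => g₁ ys * g₂ ys).prod
  have hf : f ∉ 𝔔.asIdeal := by
    intro h
    rcases 𝔔.isPrime.mem_or_mem h with h | h
    · exact hf₀ h
    · obtain ⟨z, hz, hz𝔔⟩ := exists_mem_of_prod_mem 𝔔.isPrime _ h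
      obtain ⟨ys, -, rfl⟩ := List.mem_map.mp hz
      rcases 𝔔.isPrime.mem_or_mem hz𝔔 with h' | h'
      · exact hg₁ ys h'
      · exact hg₂ ys h'
  refine ⟨f, hf, fun 𝔔' hf' ys hys hys' => ?_⟩
  -- divisors of `f` are outside `𝔔'`
  have hf₀' : f₀ ∉ 𝔔'.asIdeal := not_mem_of_dvd (Dvd.intro _ rfl) hf'
  have hprod : g₁ ys * g₂ ys ∣ f := by
    refine Dvd.dvd.mul_left (List.dvd_prod ?_) f₀
    exact List.mem_map.mpr ⟨ys, List.mem_sublists.mpr hys, rfl⟩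
  have hg₁' : g₁ ys ∉ 𝔔'.asIdeal := not_mem_of_dvd ((dvd_mul_right _ _).trans hprod) hf'
  have hg₂' : g₂ ys ∉ 𝔔'.asIdeal := not_mem_of_dvd ((dvd_mul_left _ _).trans hprod) hf'
  -- the members of `ys` lie in `𝔔`
  have hys𝔔 : ∀ y ∈ ys, y ∈ 𝔔.asIdeal := fun y hy => hsub 𝔔' hf₀' y (hys.subset hy) (hys' y hy)
  have hcond : ys.Sublist xs ∧ ∀ y ∈ ys, y ∈ 𝔔.asIdeal := ⟨hys, hys𝔔⟩
  have h1 := Classical.choose_spec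
    (exists_nhd_quotient_isRegularLocalRing k 𝔔 ys hcond.2 (hreg ys hcond.1 hcond.2))
  have h2 := Classical.choose_spec (exists_nhd_isRegular_and_dim 𝔔 ys (hseq ys hcond.1 hcond.2))
  have hg₁eq : g₁ ys = Classical.choose
      (exists_nhd_quotient_isRegularLocalRing k 𝔔 ys hcond.2 (hreg ys hcond.1 hcond.2)) := by
    simp only [g₁, dif_pos hcond]
  have hg₂eq : g₂ ys = Classical.choose
      (exists_nhd_isRegular_and_dim 𝔔 ys (hseq ys hcond.1 hcond.2)) := by
    simp only [g₂, dif_pos hcond]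
  rw [hg₁eq] at hg₁'
  rw [hg₂eq] at hg₂'
  exact ⟨h1.2 𝔔' hg₁' hys', h2.2 𝔔' hg₂' hys'⟩

end Summit.ResolutionOfSingularities.ResolutionOfSingularities.Theorems.FRationalResolution.StrataRegularNhd

end
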